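import Summits.AtomisticToContinuum.HydrodynamicLimit.Theorems.PolynomialCompression.Negative.ConstantProfiles
import Summits.AtomisticToContinuum.HydrodynamicLimit.Theorems.DiluteSelfConsistency.Negative.Tightness
import Summits.AtomisticToContinuum.HydrodynamicLimit.Theorems.ImplosionDichotomyDiluteSelfConsistencyPdeForm
import Summits.AtomisticToContinuum.HydrodynamicLimit.Theorems.HydroLimitInBand.Negative.ShearReduction

/-!
# `DiluteSelfConsistency` along σ-uniformly bounded global families; the stationary shear flow (stmt-3091)

Support lemmas for the crux `ImplosionDichotomy.DiluteSelfConsistency` (stmt-AtomisticToContinuum-3091), line `birth`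
(rev c2, `Cruxes/DiluteSelfConsistency/Lines/birth.lean`), Case I (`stub_boundedIdealDiluteSmooth`: σ-stability of
NON-imploding developments). The one mechanism by which the tree can CERTIFY the crux at a given profile today:

* `DiluteSelfConsistencyBoundedFamilies.pde_of_boundedGlobalFamily` — **the bounded-family principle** (particle-free
  form). If for every small `σ` and EVERY horizon `T` the pinned data `(rhoLim (profileOf a₀) σ, u₀, θ₀)` launch SOME
  classical hard-sphere-Euler solution on `[0, T)` with density `≤ B` (`B` independent of `σ` and `T`), then for every level
  `η > 0`, below an explicit threshold, EVERY classical solution with the pinned data has packing `< η` on its interval of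
  existence: the reference solution is dilute (`Bσ³ ≤ η₁/2`), so by uniqueness in the WHOLE typed class
  (`PolynomialCompressionConstantProfiles.unique_of_dilute_eos` — the competitor is not assumed dilute) every solution
  with the same data coincides with it on `[0, T)`, and `Bσ³ < η`. This is exactly what a proof of Case I must supply
  profile by profile (a σ-uniform `L∞` density bound along ONE development per horizon); the principle turns any future
  global-existence-with-bounds theorem for the pinned data into the crux at that profile.
* `DiluteSelfConsistencyBoundedFamilies.holdsAt_of_boundedGlobalFamily` — the same in the crux's own (tied) vocabulary
  `DiluteSelfConsistencyHoldsAt` (`Negative/Tightness.lean`; data pinning `admissible_iff_data`, tie transfer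
  `tendstoHydroFieldsAt_zero_transfer`).
* `diluteSelfConsistencyHoldsAt_shear` — **the crux holds at the stationary shear profile** `(a₀, θ₀, u₀) =
  (1, 1, sin(2π x₁) e₀)` (registered sub-goal): the isothermal parallel shear flow
  (`HydroLimitInBandNegative.isHardSphereEulerSolution_shear`, density `≡ 1` = `rhoLim` of the unit activity,
  `rhoLim_const_eq_one`) is a global bounded family. First NON-CONSTANT profile at which the crux is a theorem.

prover-line-stmt-AtomisticToContinuum-3091-c2-0 (line `birth`, rev c2).
-/

noncomputable section

namespace Summit.AtomisticToContinuum.HydrodynamicLimit.Theorems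

open MeasureTheory Filter Set Topology
open Literature.MathematicalPhysics.KineticTheory Literature.Analysis.FluidPDE
open Literature.Analysis.FunctionSpaces
open Summit.AtomisticToContinuum.HydrodynamicLimit.Theses.ImplosionDichotomy (DiluteSelfConsistency)

namespace DiluteSelfConsistencyBoundedFamilies

open PolynomialCompressionPDE (Flows admissible_iff_data continuous_slices_zero)
open PolynomialCompressionConstantProfiles (rhoLim_const_eq_one unique_of_dilute_eos)
open DenseExcursionDichotomy (tendstoHydroFieldsAt_zero_transfer)

/-- **THE BOUNDED-FAMILY PRINCIPLE (particle-free form).** Let `(a₀, θ₀, u₀)` be profiles with `a₀` continuous and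
positive, and suppose that for every `0 < σ < σ₁` and every horizon `T` the pinned data `(rhoLim (profileOf a₀) σ, u₀, θ₀)`
launch a classical hard-sphere-Euler solution on `[0, T)` with density `≤ B`. Then for every `η > 0` there is `σ₀ > 0` such
that for `0 < σ < σ₀` EVERY classical solution on any `[0, T)` with the pinned data has packing `ρ_t(x)σ³ < η` on `[0, T)`
(the reference solution is dilute, uniqueness in the whole typed class, `Bσ³ < η`). [folklore] -/
theorem pde_of_boundedGlobalFamily {a₀ θ₀ : T3 → ℝ} {u₀ : T3 → V3} (ha : Continuous a₀) (ha0 : ∀ x, 0 < a₀ x)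
    {σ₁ B : ℝ} (hσ₁ : 0 < σ₁)
    (hfam : ∀ σ : ℝ, 0 < σ → σ < σ₁ → ∀ T : ℝ, ∃ (ρ₁ θ₁ : ℝ → T3 → ℝ) (u₁ : ℝ → T3 → V3),
      IsHardSphereEulerSolution σ T ρ₁ u₁ θ₁ ∧ ρ₁ 0 = rhoLim (profileOf a₀ ha ha0) σ ∧ u₁ 0 = u₀ ∧ θ₁ 0 = θ₀ ∧
        ∀ t ∈ Ico 0 T, ∀ x, ρ₁ t x ≤ B)
    {η : ℝ} (hη : 0 < η) :
    ∃ σ₀ : ℝ, 0 < σ₀ ∧ ∀ σ : ℝ, 0 < σ → σ < σ₀ →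
      ∀ (T : ℝ) (ρ θ : ℝ → T3 → ℝ) (u : ℝ → T3 → V3), IsHardSphereEulerSolution σ T ρ u θ →
        ρ 0 = rhoLim (profileOf a₀ ha ha0) σ → u 0 = u₀ → θ 0 = θ₀ → ∀ t ∈ Ico 0 T, ∀ x, ρ t x * σ ^ 3 < η := by
  obtain ⟨η₁, hη₁, U⟩ := unique_of_dilute_eos
  set B' : ℝ := max B 1 with hB'
  have hB'1 : 1 ≤ B' := le_max_right _ _
  have hB'0 : 0 < B' := one_pos.trans_le hB'1
  have hBB' : B ≤ B' := le_max_left _ _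
  refine ⟨min σ₁ (min 1 (min (η / (2 * B')) (η₁ / (2 * B')))),
    lt_min hσ₁ (lt_min one_pos (lt_min (by positivity) (by positivity))), ?_⟩
  intro σ hσ hσlt T ρ θ u hE h1 h2 h3 t ht x
  have hσ₁' : σ < σ₁ := lt_of_lt_of_le hσlt (min_le_left _ _)
  have hσ1 : σ < 1 := lt_of_lt_of_le hσlt ((min_le_right _ _).trans (min_le_left _ _))
  have hση : σ < η / (2 * B') :=
    lt_of_lt_of_le hσlt ((min_le_right _ _).trans ((min_le_right _ _).trans (min_le_left _ _)))
  have hση₁ : σ < η₁ / (2 * B') :=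
    lt_of_lt_of_le hσlt ((min_le_right _ _).trans ((min_le_right _ _).trans (min_le_right _ _)))
  have hσ3 : σ ^ 3 ≤ σ := pow_le_of_le_one hσ.le hσ1.le three_ne_zero
  have hσ30 : 0 ≤ σ ^ 3 := pow_nonneg hσ.le 3
  rw [lt_div_iff₀ (by positivity)] at hση hση₁
  have hBσ : B' * σ ^ 3 ≤ B' * σ := mul_le_mul_of_nonneg_left hσ3 hB'0.le
  -- the reference solution on the SAME horizon, dilute
  obtain ⟨ρ₁, θ₁, u₁, hE₁, h1₁, h2₁, h3₁, hB⟩ := hfam σ hσ hσ₁' T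
  have hpk : ∀ s ∈ Ico 0 T, ∀ y, ρ₁ s y * σ ^ 3 ≤ η₁ / 2 := by
    intro s hs y
    have h := (hB s hs y).trans hBB'
    have : ρ₁ s y * σ ^ 3 ≤ B' * σ ^ 3 := mul_le_mul_of_nonneg_right h hσ30
    linarith
  -- uniqueness in the whole typed class: `ρ = ρ₁` on `[0, T)`
  obtain ⟨hρt, -, -⟩ := U σ hσ T T ρ₁ θ₁ u₁ ρ θ u hE₁ hE hpk (h1₁.trans h1.symm) (h2₁.trans h2.symm)
    (h3₁.trans h3.symm) t (by rwa [min_self])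
  have hx : ρ t x ≤ B' := (le_of_eq (congrFun hρt x)).trans ((hB t ht x).trans hBB')
  have : ρ t x * σ ^ 3 ≤ B' * σ ^ 3 := mul_le_mul_of_nonneg_right hx hσ30
  linarith

/-- **THE BOUNDED-FAMILY PRINCIPLE (tied form).** Under the hypotheses of `pde_of_boundedGlobalFamily` and for continuous
positive profiles, for every `η > 0` there is `σ₀ > 0` with `DiluteSelfConsistencyHoldsAt η a₀ θ₀ u₀ σ₀` — the crux's inner
clause at these profiles: the tie through the given flow family is the tie through every family
(`tendstoHydroFieldsAt_zero_transfer`) and pins the data (`admissible_iff_data`; `T > 0` from `t ∈ Ico 0 T`). [folklore] -/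
theorem holdsAt_of_boundedGlobalFamily {a₀ θ₀ : T3 → ℝ} {u₀ : T3 → V3} (ha : Continuous a₀) (hθ : Continuous θ₀)
    (hu : Continuous u₀) (ha0 : ∀ x, 0 < a₀ x) (hθ0 : ∀ x, 0 < θ₀ x) {σ₁ B : ℝ} (hσ₁ : 0 < σ₁)
    (hfam : ∀ σ : ℝ, 0 < σ → σ < σ₁ → ∀ T : ℝ, ∃ (ρ₁ θ₁ : ℝ → T3 → ℝ) (u₁ : ℝ → T3 → V3),
      IsHardSphereEulerSolution σ T ρ₁ u₁ θ₁ ∧ ρ₁ 0 = rhoLim (profileOf a₀ ha ha0) σ ∧ u₁ 0 = u₀ ∧ θ₁ 0 = θ₀ ∧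
        ∀ t ∈ Ico 0 T, ∀ x, ρ₁ t x ≤ B)
    {η : ℝ} (hη : 0 < η) :
    ∃ σ₀ : ℝ, 0 < σ₀ ∧ DiluteSelfConsistencyHoldsAt η a₀ θ₀ u₀ σ₀ := by
  obtain ⟨σ₂, hσ₂, H⟩ := pde_of_boundedGlobalFamily ha ha0 hσ₁ hfam hη
  obtain ⟨σ₃, hσ₃, -, G⟩ := admissible_iff_data ha hθ hu ha0 hθ0
  refine ⟨min σ₃ σ₂, lt_min hσ₃ hσ₂, fun σ hσ hσlt T ρ θ u hE Φ htie t ht x => ?_⟩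
  have hσ₃' : σ < σ₃ := lt_of_lt_of_le hσlt (min_le_left _ _)
  have hσ₂' : σ < σ₂ := lt_of_lt_of_le hσlt (min_le_right _ _)
  obtain ⟨hρc, huc, hθc⟩ := continuous_slices_zero hE (ht.1.trans_lt ht.2)
  have hall : ∀ Ψ : Flows σ, TendstoHydroFieldsAt (fun N => localGibbsLaw σ a₀ u₀ θ₀ N (Ψ N)) Ψ ρ u θ 0 :=
    fun Ψ => tendstoHydroFieldsAt_zero_transfer Φ Ψ htie
  obtain ⟨-, G'⟩ := G σ hσ hσ₃'
  obtain ⟨h1, h2, h3⟩ := (G' ρ θ u hρc huc hθc).1 hall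
  exact H σ hσ hσ₂' T ρ θ u hE h1 h2 h3 t ht x

/-- **The stationary shear flow is a σ-uniformly bounded global family for its own pinned data.** For the profiles
`(a₀, θ₀, u₀) = (1, 1, sin(2π x₁) e₀)` and every `σ` below the statics threshold, on every horizon `T` the isothermal shear
flow `(1, sin(2π x₁) e₀, 1)` is a classical solution (`isHardSphereEulerSolution_shear`) with the pinned data
(`rhoLim (profileOf 1) σ ≡ 1`, `rhoLim_const_eq_one`) and density `≤ 1`. [folklore] -/
theorem shear_boundedGlobalFamily :
    ∃ σ₁ : ℝ, 0 < σ₁ ∧ ∀ σ : ℝ, 0 < σ → σ < σ₁ → ∀ T : ℝ, ∃ (ρ₁ θ₁ : ℝ → T3 → ℝ) (u₁ : ℝ → T3 → V3),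
      IsHardSphereEulerSolution σ T ρ₁ u₁ θ₁ ∧
        ρ₁ 0 = rhoLim (profileOf (fun _ : T3 => (1 : ℝ)) continuous_const fun _ => one_pos) σ ∧
        u₁ 0 = HydroLimitInBandNegative.shearVelocity ∧ θ₁ 0 = (fun _ => (1 : ℝ)) ∧
        ∀ t ∈ Ico 0 T, ∀ x, ρ₁ t x ≤ 1 := by
  obtain ⟨σ₁, hσ₁, -, G⟩ := admissible_iff_data (a₀ := fun _ : T3 => (1 : ℝ)) (θ₀ := fun _ => (1 : ℝ))
    (u₀ := HydroLimitInBandNegative.shearVelocity) continuous_const continuous_const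
    HydroLimitInBandNegative.continuous_shearVelocity (fun _ => one_pos) (fun _ => one_pos)
  refine ⟨σ₁, hσ₁, fun σ hσ hσlt T => ⟨fun _ _ => 1, fun _ _ => 1, fun _ x => HydroLimitInBandNegative.shearVelocity x,
    HydroLimitInBandNegative.isHardSphereEulerSolution_shear σ T, ?_, rfl, rfl, fun _ _ _ => le_rfl⟩⟩
  obtain ⟨hS, -⟩ := G σ hσ hσlt
  funext y
  exact (rhoLim_const_eq_one one_pos hS y).symm

end DiluteSelfConsistencyBoundedFamilies

/-- **`DiluteSelfConsistency` HOLDS AT THE STATIONARY SHEAR PROFILE** `(a₀, θ₀, u₀) = (1, 1, sin(2π x₁) e₀)` — the first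
non-constant profile at which the crux is a theorem: for every `η > 0` there is `σ₀ > 0` such that for `0 < σ < σ₀` every
classical hard-sphere-Euler solution on `[0, T)` tied at `t = 0` to the local Gibbs laws of these profiles keeps packing
`ρ_t(x)σ³ < η` (it IS the stationary shear flow, of packing `σ³`: bounded-family principle + uniqueness). [folklore] -/
theorem diluteSelfConsistencyHoldsAt_shear :
    ∀ η : ℝ, 0 < η → ∃ σ₀ : ℝ, 0 < σ₀ ∧
      DiluteSelfConsistencyHoldsAt η (fun _ => 1) (fun _ => 1) HydroLimitInBandNegative.shearVelocity σ₀ := by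
  intro η hη
  obtain ⟨σ₁, hσ₁, hfam⟩ := DiluteSelfConsistencyBoundedFamilies.shear_boundedGlobalFamily
  exact DiluteSelfConsistencyBoundedFamilies.holdsAt_of_boundedGlobalFamily continuous_const continuous_const
    HydroLimitInBandNegative.continuous_shearVelocity (fun _ => one_pos) (fun _ => one_pos) hσ₁ hfam hη

end Summit.AtomisticToContinuum.HydrodynamicLimit.Theorems

end
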